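import Summits.QuantumFields.BalabanUV.Beta.KernelWardRelativeEnd
import Summits.QuantumFields.BalabanUV.Beta.KernelWardHColumnWall
import Summits.QuantumFields.BalabanUV.Beta.WardLocusStep

/-!
# `BalabanUV.Beta.KernelWardLevels` — binder row D1, the WARD binder hW: THE ROOT ASSEMBLED BY NAME, LEVEL BY LEVEL
# (the relative inverse, the ℋ-column Ward law and the block-stencil sockets `hSd` plugged; what is left is the two
# first-order Ward laws, the scalar locks and the W-side)

HONEST FRAMING (cell charter, verbatim): «discharging `BetaPertH` makes Bałaban's UV stability UNCONDITIONAL — a real constructive-QFT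
result; it is NOT the continuum limit and NOT the Clay problem.»  DERIVED cell analysis (pub-balaban β sub-cell, lineage an1 «direct one-loop
in Bałaban's gauge», gen 26, item D1-hW-END0 of the cell journal); every declaration is [folklore] kernel algebra over objects ALREADY in the
tree, cited BY NAME; no statement of Bałaban's papers is typed, no `[cite:]` tag, no `def … : Prop`; it instantiates NO binder of the
β-function wall by itself.  NOT `BetaPertH`, NOT continuum, NOT Clay.
HONEST DEPENDENCY (cell records, verbatim): «continuum YM on T⁴ ⇐ BetaPertH ∧ nine spine estimates (0/9 proved); BetaPertH ⇐ (D1) ∧ (D4) ∧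
CAP+tail; G-an2-4 gates asym, D1 and NE2/3/4.»
ABSOLUTE RULE (cell charter, verbatim): «No internally-minted statement may enter as a cited fact. Every hypothesis is either kernel-proved in
this package or a verbatim quotation of a PUBLISHED theorem with page reference. The manuscript(s) under audit are NOT citable for their own
disputed steps — they are the thing under adjudication; programme-internal (2001/route/tribunal) claims are never citable.»

WHERE THIS SITS.  Row D1's END is `OneStepKernelFamily.d1Drift_of_D1Tel_D1Rep`; its binder hW for the wall family is
  `T_hW := ∀ j, WardTransversal (flipK (TbalOf Lc (JsBalBmNAtOf (d := 3) hLc.pos (ctrOff_mem_box hLc.pos) cE cVH cΛ W Cw δw hδw hW) j))`,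
and its typed ROOT is `KernelWardRelativeEnd.wardTransversal_flipK_TbalOf_JsBalBmNAtOf_ctrC` (p208646) with `∀ j`-sockets
`M hM h3 h4 ∣ cH hH ∣ X hX hEX ∣ X₂ Nr hX₂ hNr hEX₂ ∣ hSd hWd hN0`.  Since then the swarm landed, BY NAME:
* (W-L1) the relative inverse at every step — `BorderedHessian.relInv_coDressKBmAt_KInvStep_bhKStepAt` (an2, p209364), `M j := bhKStepAt 3 ρ_c Lc j`,
  `hM := spr_bhKStepAt`;
* (W-LH) the ℋ-column Ward law at every step — `KernelWardHColumnWall.hH_KInvStep` (leaf-07, p209779), `cH j := (stepScale 3 Lc j · Lc⁴)⁻¹`;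
* (W-LS0-lock) / (W-LS-lock)_{j ≥ 1} — the block-stencil socket `hSd` REDUCED to a first-order Ward law of ONE stencil plus a scalar lock:
  `WardLocusS0N.hSd_S0NAt_of_wilsonWard` (leaf-10, p209131: level `0`, the Wilson cubic stencil `wilsonA`) and
  `WardLocusStep.hSd_SstepNAt_of_e3Ward` (leaf-10: level `j+1`, the value-function cubic stencil `e3NAtOf … (j+1)`).

WHAT IS HERE (all `[folklore]`, nothing of the wall discharged by itself):
* §1 the block rotation GENERATOR `diagK (ξ • Σ_{v ∈ box} legInd ρ (N•y + v))` is LOCALISED (`loc_diagK_smul_sum_legInd`, any `N, ρ, ξ, y`; via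
  leaf-07's `loc_of_bdd_support`) and COMMUTES with the axial projector (`DiagonalContact.comp_axEc_diagK_comm`) — the root's sockets hX, hEX
  (and `WardLocusCubic.divV_e3NAtOf_eq_conjV`'s hX, hEX) for this generator family are therefore theorems;
* §2 `wardTransversal_flipK_TbalOf_JsBalBmNAtOf_ctrC_level` — the root AT ONE LEVEL `j` (its proof is per level) with (W-L1) and (W-LH) PLUGGED:
  remaining level-`j` sockets `X hX hEX X₂ Nr hX₂ hNr hEX₂ hSd hWd hN0` against `𝕄 j = bhKStepAt 3 ρ_c Lc j` and `cH j = (stepScale 3 Lc j · Lc⁴)⁻¹`;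
* §3 LEVEL ZERO ASSEMBLED — `wardTransversal_flipK_TbalOf_JsBalBmNAtOf_ctrC_zero_of_wilsonWard`: hypotheses EXACTLY (i) the WILSON WARD DIVERGENCE LAW
  `hEw : ∀ u, divV (wilsonA 3) u = cE' • conjV (ffK (bhKAt 3 ρ_c Lc)) (diagK (legInd ρ_c u))` (statement-level; item (W-LS0-E), claimed by seat
  leaf-05 — an1-g26's three-engine toy `HOME/b2b-balaban-beta-an1-g26/toy/LS0E-TOY-RESULT.md` finds `cE' = 1/2` exactly at `d = 1, 2, 3`), (ii) the
  SCALAR LOCK `cE·cE'·Lc⁴ = −cVH` (at `cE' = 1/2` this is the hR normalisation hyperplane `2·cVH = −cE·Lc⁴` of `S0NReflection.S0NAt_bref_iff`: ONE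
  hyperplane serves both binders), (iii) the W-side (L4) at level 0: `X₂ Nr hX₂ hNr hEX₂ hWd hN0` against the DETERMINED generator
  `X₀ y = diagK ((cE·cE'/Lc⁴) • Σ_{v ∈ box} legInd ρ_c (Lc•y + v))`;
* §4 LEVEL `j+1` ASSEMBLED — `…_ctrC_succ_of_e3Ward`: hypotheses (i′) the value-function cubic Ward law at level `j+1` with constant `c3`
  (statement-level; `WardLocusCubic.divV_e3NAtOf_eq_conjV` (leaf-10) derives it from the composite block Ward law), (ii′) the lock
  `cE·wE(j+1)·c3·(stepScale (j+1)·Lc⁴) = −cVH·wVH(j+1)`, (iii′) the W-side at level `j+1` against `X_{j+1} y = diagK (ξ_{j+1} • Σ …)`,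
  `ξ_{j+1} = cE·wE(j+1)·c3 / (stepScale (j+1)·Lc⁴)`;
* §5 EVERY LEVEL — `wardTransversal_flipK_TbalOf_JsBalBmNAtOf_ctrC_of_wardLaws`: conclusion LITERALLY `T_hW`; hypotheses = (i) + (i′)_{∀ j} + (ii) +
  (ii′)_{∀ j} + the W-side family (L4) against the generator scale `xiAt`.
SOCKET LEDGER after this file (hW): (W-L1) closed (an2) ∣ (W-LH) closed (leaf-07) ∣ hX/hEX closed (§1) ∣ (W-LS0) ⟸ Wilson Ward law (W-LS0-E,
leaf-05) + lock ∣ (W-LS)_{j ≥ 1} ⟸ cubic Ward laws (statement-level) + locks ∣ (L4) W-side external (the same W-family sockets as hR's (L4)).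
hW is ONE of four binders {hW, hR, D1Tel, D1Rep} of row D1; 0 wall binders are instantiated here; «D1 DISCHARGE NO DATE» unchanged.
-/

noncomputable section

open Finset
open scoped BigOperators
open Literature.MathematicalPhysics.QuantumFieldTheory
open Literature.MathematicalPhysics.QuantumFieldTheory.Balaban1983to89
open Literature.MathematicalPhysics.QuantumFieldTheory.Balaban1983to89.Beta
open B12Sec2to5 (l1 l1_nonneg)
open B6BondElimination (unitVec unitVec_apply)
open ExpKernelCalculus (MKer Decays BiLoc comp tr tadpole VertexFamily₂ shiftK)
open PolarizationSign (WardTransversal)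
open KernelWard (divV divW)
open StepJetData (wilsonA)
open AffineAveraging (box toSite)
open AveragingContoursRooted (ctrOff ctrOff_mem_box)
open OneStepResolventKernel (Fib LocStencil JetData)
open OneStepKernelFamily (KInvStep colH vertexOfK TbalOf flipK)
open BalabanStepJetsSucc (wE wVH)
open Summit.QuantumFields.BalabanUV.Beta.TameKernelCalculus
open Summit.QuantumFields.BalabanUV.Beta.ChartConjugation (conjV conjW)
open Summit.QuantumFields.BalabanUV.Beta.ChartConjugationRelative (RelInv)
open Summit.QuantumFields.BalabanUV.Beta.AxialDressingRooted (dressBmAt coDressKBmAt TbalOf_dressBmAt decays_coDressKBmAt_KInvStep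
  shiftK_coDressKBmAt_KInvStep one_le_of_neZero axEc spr_axEc)
open Summit.QuantumFields.BalabanUV.Beta.SpineRooted (S0NAt SstepNAt e3NAtOf JsBal0NAtOf JsBalBmNAtOf JsBal0NAtOf_S_translate
  JsBal0NAtOf_W_translate JsBal0NAtOf_S_zero JsBal0NAtOf_S_succ JsBal0NAtOf_W)
open Summit.QuantumFields.BalabanUV.Beta.KernelWardRelative (gaugeWt wardTransversal_flipK_hessKer_conj_rel)
open Summit.QuantumFields.BalabanUV.Beta.BorderedHessian (bhKAt bhKStepAt bhKStepAt_zero stepScale spr_bhKStepAt diagK diagK_apply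
  comp_axEc_diagK_comm relInv_coDressKBmAt_KInvStep_bhKStepAt)
open Summit.QuantumFields.BalabanUV.Beta.AveragingWardRootedStencils (legInd legInd_apply legSite_inl legSite_inr)
open Summit.QuantumFields.BalabanUV.Beta.WardLocusStencils (ffK)
open Summit.QuantumFields.BalabanUV.Beta.WardLocusS0N (hSd_S0NAt_of_wilsonWard)
open Summit.QuantumFields.BalabanUV.Beta.WardLocusStep (hSd_SstepNAt_of_e3Ward)
open Summit.QuantumFields.BalabanUV.Beta.KernelWardHColumn (loc_of_bdd_support)
open Summit.QuantumFields.BalabanUV.Beta.KernelWardHColumnWall (hH_KInvStep)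

namespace Summit.QuantumFields.BalabanUV.Beta.KernelWardLevels

variable {d : ℕ}

/-! ## §1 The block rotation generator is localised and commutes with the axial projector -/

/-- [folklore] A finite sum of leg indicators is entrywise bounded by the number of summands. -/
theorem abs_sum_legInd_apply_le (s : Finset (Fin (d + 1) → ℕ)) (ρ p z : Fin (d + 1) → ℤ) (b : Fib d) :
    |(∑ v ∈ s, legInd ρ (p + toSite v)) z b| ≤ s.card := by
  rw [Finset.sum_apply, Finset.sum_apply]
  calc |∑ v ∈ s, legInd ρ (p + toSite v) z b| ≤ ∑ v ∈ s, |legInd ρ (p + toSite v) z b| := Finset.abs_sum_le_sum_abs _ _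
    _ ≤ ∑ _v ∈ s, (1 : ℝ) := Finset.sum_le_sum fun v _ => by rw [legInd_apply]; split_ifs <;> simp
    _ = s.card := by simp

/-- [folklore] **THE BLOCK ROTATION GENERATOR IS LOCALISED.**  `diagK (ξ • Σ_{v ∈ box (d+1) N} legInd ρ (N•y + v))` — the diagonal generator of
the background gauge rotation of the coarse site `y` acting on the legs of a `ρ`-rooted stencil — is a bounded diagonal kernel supported on the
finitely many fine sites `N•y + v` (fluctuation legs) and `N•y + v − ρ` (multiplier legs), hence `Loc` (leaf-07's `loc_of_bdd_support`).
This is the root's socket hX (and `WardLocusCubic.divV_e3NAtOf_eq_conjV`'s hX) for the generator family of the block Ward identity. -/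
theorem loc_diagK_smul_sum_legInd (N : ℕ) (ρ : Fin (d + 1) → ℤ) (ξ : ℝ) (y : Fin (d + 1) → ℤ) :
    Loc (diagK (ξ • ∑ v ∈ box (d + 1) N, legInd ρ ((N : ℤ) • y + toSite v))) := by
  classical
  set p : Fin (d + 1) → ℤ := (N : ℤ) • y with hp
  refine loc_of_bdd_support p p (B := |ξ| * (box (d + 1) N).card)
    (R := 2 * ∑ v ∈ box (d + 1) N, (l1 (p + toSite v - p) + l1 (p + toSite v - ρ - p))) ?_ ?_
  · intro z z' a b
    rw [diagK_apply]
    split_ifs with h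
    · rw [Pi.smul_apply, Pi.smul_apply, smul_eq_mul, abs_mul]
      exact mul_le_mul_of_nonneg_left (abs_sum_legInd_apply_le _ _ _ _ _) (abs_nonneg _)
    · rw [abs_zero]; positivity
  · intro z z' a b hne
    rw [diagK_apply] at hne
    split_ifs at hne with h
    · obtain ⟨rfl, rfl⟩ := h
      rw [Pi.smul_apply, Pi.smul_apply, smul_eq_mul] at hne
      have hS : (∑ v ∈ box (d + 1) N, legInd ρ (p + toSite v)) z a ≠ 0 := fun h0 => hne (by rw [h0, mul_zero])
      rw [Finset.sum_apply, Finset.sum_apply] at hS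
      obtain ⟨v, hv, hvne⟩ := Finset.exists_ne_zero_of_sum_ne_zero hS
      rw [legInd_apply] at hvne
      split_ifs at hvne with hsite
      · have hT0 : ∀ w ∈ box (d + 1) N, 0 ≤ l1 (p + toSite w - p) + l1 (p + toSite w - ρ - p) :=
          fun w _ => add_nonneg (l1_nonneg _) (l1_nonneg _)
        have hsum : l1 (p + toSite v - p) + l1 (p + toSite v - ρ - p) ≤
            ∑ w ∈ box (d + 1) N, (l1 (p + toSite w - p) + l1 (p + toSite w - ρ - p)) := Finset.single_le_sum hT0 hv
        have hz : l1 (z - p) ≤ l1 (p + toSite v - p) + l1 (p + toSite v - ρ - p) := by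
          rcases a with α | μ
          · rw [legSite_inl] at hsite
            rw [hsite]; exact le_add_of_nonneg_right (l1_nonneg _)
          · rw [legSite_inr] at hsite
            have hz' : z = p + toSite v - ρ := by rw [← hsite]; abel
            rw [hz']; exact le_add_of_nonneg_left (l1_nonneg _)
        linarith
      · exact absurd rfl hvne
    · exact absurd rfl hne

/-- [folklore] … and it COMMUTES WITH THE AXIAL PROJECTOR `axEc ρ N` (any diagonal contact does: `DiagonalContact.comp_axEc_diagK_comm`) — the root's
socket hEX. -/
theorem comp_axEc_diagK_smul_sum_legInd_comm (N : ℕ) (ρ ρ' : Fin (d + 1) → ℤ) (ξ : ℝ) (y : Fin (d + 1) → ℤ) :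
    comp (axEc ρ' N) (diagK (ξ • ∑ v ∈ box (d + 1) N, legInd ρ ((N : ℤ) • y + toSite v))) =
      comp (diagK (ξ • ∑ v ∈ box (d + 1) N, legInd ρ ((N : ℤ) • y + toSite v))) (axEc ρ' N) :=
  comp_axEc_diagK_comm _ ρ' N

/-! ## §2 The root at one level, with the relative inverse (W-L1) and the ℋ-column Ward law (W-LH) plugged -/
section Level
variable {Lc : ℕ} [NeZero Lc]

/-- **THE hW ROOT AT LEVEL `j`, (W-L1) AND (W-LH) PLUGGED BY NAME.**  For the centred Π_bm-co-dressed native spine `JsBalBmNAtOf` over `axEc ρ_c Lc`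
(`ρ_c = toSite (ctrOff 4 Lc)`): the relative inverse `𝕄 j := bhKStepAt 3 ρ_c Lc j` with all four rules (`relInv_coDressKBmAt_KInvStep_bhKStepAt`, an2)
and spread (`spr_bhKStepAt`), the ℋ-column Ward law with `cH j = (stepScale 3 Lc j · Lc⁴)⁻¹` (`hH_KInvStep`, leaf-07), block covariance of the jets
(`JsBal0NAtOf_S_translate` / `JsBal0NAtOf_W_translate`).  REMAINING level-`j` sockets: the generator `X` (localised, `axEc`-commuting), the W-side
contact / remainder families `X₂`, `Nr`, and the pure-gauge jet laws `hSd` (first order), `hWd` + `hN0` (second order).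
CONCLUSION: `WardTransversal (flipK (TbalOf Lc (JsBalBmNAtOf …) j))` — member `j` of the wall binder hW.  [folklore] -/
theorem wardTransversal_flipK_TbalOf_JsBalBmNAtOf_ctrC_level (hLc : Odd Lc) (cE cVH cΛ : ℝ)
    (W : ℕ → Fin 4 → (Fin 4 → ℤ) → Fin 4 → (Fin 4 → ℤ) → MKer 4 (Fib 3)) (Cw δw : ℕ → ℝ) (hδw : ∀ j, 0 < δw j)
    (hW : ∀ j, VertexFamily₂ (W j) Lc (Cw j) (δw j))
    (hWt : ∀ (j : ℕ) (μ : Fin 4) (y : Fin 4 → ℤ) (ν : Fin 4) (y' t : Fin 4 → ℤ),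
      W j μ (y + t) ν (y' + t) = shiftK (-((Lc : ℤ) • t)) (W j μ y ν y'))
    (j : ℕ) (X : (Fin 4 → ℤ) → MKer 4 (Fib 3)) (hX : ∀ y, Loc (X y))
    (hEX : ∀ y, comp (axEc (toSite (ctrOff 4 Lc)) Lc) (X y) = comp (X y) (axEc (toSite (ctrOff 4 Lc)) Lc))
    (X₂ Nr : (Fin 4 → ℤ) → Fin 4 → (Fin 4 → ℤ) → MKer 4 (Fib 3)) (hX₂ : ∀ y ν y', Loc (X₂ y ν y')) (hNr : ∀ y ν y', Loc (Nr y ν y'))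
    (hEX₂ : ∀ y ν y', comp (axEc (toSite (ctrOff 4 Lc)) Lc) (X₂ y ν y') = comp (X₂ y ν y') (axEc (toSite (ctrOff 4 Lc)) Lc))
    (hSd : ∀ y : Fin 4 → ℤ, (stepScale 3 Lc j * (Lc : ℝ) ^ (3 + 1))⁻¹ • ∑ v ∈ box 4 Lc,
      divV (JsBal0NAtOf (d := 3) hLc.pos (ctrOff_mem_box hLc.pos) cE cVH cΛ W Cw δw hδw hW j).S ((Lc : ℤ) • y + toSite v) =
        conjV (bhKStepAt 3 (toSite (ctrOff 4 Lc)) Lc j) (X y))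
    (hWd : ∀ (y : Fin 4 → ℤ) (ν : Fin 4) (y' : Fin 4 → ℤ),
      divW (W j) y ν y' =
        conjW (bhKStepAt 3 (toSite (ctrOff 4 Lc)) Lc j) 0 (vertexOfK (coDressKBmAt (toSite (ctrOff 4 Lc)) Lc (KInvStep (d := 3) Lc j)) Lc
          (JsBal0NAtOf (d := 3) hLc.pos (ctrOff_mem_box hLc.pos) cE cVH cΛ W Cw δw hδw hW j).S ν y') (X y) 0 (X₂ y ν y') + Nr y ν y')
    (hN0 : ∀ y ν y', tadpole (coDressKBmAt (toSite (ctrOff 4 Lc)) Lc (KInvStep (d := 3) Lc j)) (Nr y ν y') = 0) :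
    WardTransversal (flipK (TbalOf Lc (JsBalBmNAtOf (d := 3) hLc.pos (ctrOff_mem_box hLc.pos) cE cVH cΛ W Cw δw hδw hW) j)) := by
  have hWd' : ∀ (y : Fin 4 → ℤ) (ν : Fin 4) (y' : Fin 4 → ℤ),
      divW (JsBal0NAtOf (d := 3) hLc.pos (ctrOff_mem_box hLc.pos) cE cVH cΛ W Cw δw hδw hW j).W y ν y' =
        conjW (bhKStepAt 3 (toSite (ctrOff 4 Lc)) Lc j) 0 (vertexOfK (coDressKBmAt (toSite (ctrOff 4 Lc)) Lc (KInvStep (d := 3) Lc j)) Lc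
          (JsBal0NAtOf (d := 3) hLc.pos (ctrOff_mem_box hLc.pos) cE cVH cΛ W Cw δw hδw hW j).S ν y') (X y) 0 (X₂ y ν y') + Nr y ν y' := by
    rw [JsBal0NAtOf_W]; exact hWd
  show WardTransversal (flipK (TbalOf Lc (fun j => dressBmAt (ctrOff_mem_box hLc.pos)
    (JsBal0NAtOf (d := 3) hLc.pos (ctrOff_mem_box hLc.pos) cE cVH cΛ W Cw δw hδw hW j)) j))
  rw [TbalOf_dressBmAt (ctrOff_mem_box hLc.pos) _ j]
  exact wardTransversal_flipK_hessKer_conj_rel (decays_coDressKBmAt_KInvStep (ctrOff_mem_box hLc.pos) j)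
    (shiftK_coDressKBmAt_KInvStep (toSite (ctrOff 4 Lc)) j) (one_le_of_neZero Lc) (spr_bhKStepAt (ctrOff_mem_box hLc.pos) j) (spr_axEc _ _)
    (relInv_coDressKBmAt_KInvStep_bhKStepAt (ctrOff_mem_box hLc.pos) j)
    (JsBal0NAtOf (d := 3) hLc.pos (ctrOff_mem_box hLc.pos) cE cVH cΛ W Cw δw hδw hW j)
    (JsBal0NAtOf_S_translate hLc.pos (ctrOff_mem_box hLc.pos) cE cVH cΛ W Cw δw hδw hW j)
    (JsBal0NAtOf_W_translate hLc.pos (ctrOff_mem_box hLc.pos) cE cVH cΛ W Cw δw hδw hW hWt j) _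
    (hH_KInvStep (ctrOff_mem_box hLc.pos) j) X hX hEX X₂ Nr hX₂ hNr hEX₂ hSd hWd' hN0

end Level

/-! ## §3⁰ The scalar locks: the generator scale forced by the ℋ-column constant and the first-order Ward constants -/
section Scalars
/-- [folklore] The step scale at level `0` is `1`. -/
theorem stepScale_zero (d Lc : ℕ) : stepScale d Lc 0 = 1 := by simp [stepScale]

/-- [folklore] THE GENERATOR SCALE SEQUENCE `ξ j` of the block rotation generator `X j y = diagK (ξ j • Σ_{v ∈ box} legInd ρ_c (Lc•y + v))` forced by
`cH j · (first-order weight at level j) · (Ward constant at level j) = ξ j` with leaf-07's `cH j = (stepScale 3 Lc j · Lc⁴)⁻¹`: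
`ξ 0 = cE·cE'/Lc⁴` (Wilson sector, Ward constant `cE'`), `ξ (j+1) = cE·wE(j+1)·c3(j+1) / (stepScale (j+1)·Lc⁴)` (value-function cubic sector,
Ward constants `c3 (j+1)`).  A bookkeeping `def` of real numbers, not a statement. -/
def xiAt (Lc : ℕ) (cE cE' : ℝ) (c3 : ℕ → ℝ) : ℕ → ℝ
  | 0 => cE * cE' / (Lc : ℝ) ^ (3 + 1)
  | j + 1 => cE * wE 3 Lc (j + 1) * c3 (j + 1) / (stepScale 3 Lc (j + 1) * (Lc : ℝ) ^ (3 + 1))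

/-- [folklore] `xiAt` at level `0` (unfolding lemma). -/
@[simp] theorem xiAt_zero (Lc : ℕ) (cE cE' : ℝ) (c3 : ℕ → ℝ) : xiAt Lc cE cE' c3 0 = cE * cE' / (Lc : ℝ) ^ (3 + 1) := rfl

/-- [folklore] `xiAt` at level `j+1` (unfolding lemma). -/
@[simp] theorem xiAt_succ (Lc : ℕ) (cE cE' : ℝ) (c3 : ℕ → ℝ) (j : ℕ) :
    xiAt Lc cE cE' c3 (j + 1) = cE * wE 3 Lc (j + 1) * c3 (j + 1) / (stepScale 3 Lc (j + 1) * (Lc : ℝ) ^ (3 + 1)) := rfl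

/-- [folklore] THE LEVEL-ZERO LOCK, solved: with `cH 0 = (stepScale 0 · Lc⁴)⁻¹ = Lc⁻⁴` and `ξ 0 = cE·cE'/Lc⁴`, the two scalar conditions of
`WardLocusS0N.hSd_S0NAt_of_wilsonWard` read `cH·cE·cE' = ξ` (automatic) and `cH·cVH = −ξ·Lc⁴ ⇔ cE·cE'·Lc⁴ = −cVH` (the hypothesis). -/
theorem lock_zero {Lc : ℕ} [NeZero Lc] {cE cVH cE' : ℝ} (hlock : cE * cE' * (Lc : ℝ) ^ (3 + 1) = -cVH) :
    (stepScale 3 Lc 0 * (Lc : ℝ) ^ (3 + 1))⁻¹ * cE * cE' = cE * cE' / (Lc : ℝ) ^ (3 + 1) ∧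
      (stepScale 3 Lc 0 * (Lc : ℝ) ^ (3 + 1))⁻¹ * cVH = -(cE * cE' / (Lc : ℝ) ^ (3 + 1) * (Lc : ℝ) ^ (3 + 1)) := by
  have hL : (Lc : ℝ) ≠ 0 := by exact_mod_cast (NeZero.ne Lc)
  have hP : (Lc : ℝ) ^ (3 + 1) ≠ 0 := pow_ne_zero _ hL
  refine ⟨?_, ?_⟩
  · rw [stepScale_zero, one_mul]; field_simp
  · have hv : cVH = -(cE * cE' * (Lc : ℝ) ^ (3 + 1)) := by linarith [hlock]
    rw [stepScale_zero, one_mul, hv]; field_simp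

/-- [folklore] THE LEVEL-`(j+1)` LOCK, solved: with `cH (j+1) = (stepScale (j+1)·Lc⁴)⁻¹` and `ξ (j+1) = cE·wE(j+1)·c3/(stepScale (j+1)·Lc⁴)` the two
scalar conditions of `WardLocusStep.hSd_SstepNAt_of_e3Ward` read `cH·(cE·wE)·c3 = ξ` (automatic) and
`cH·(cVH·wVH) = −ξ·stepScale·Lc⁴ ⇔ cE·wE·c3·(stepScale·Lc⁴) = −cVH·wVH` (the hypothesis). -/
theorem lock_succ {Lc : ℕ} [NeZero Lc] {cE cVH c3 : ℝ} {j : ℕ}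
    (hlock : cE * wE 3 Lc (j + 1) * c3 * (stepScale 3 Lc (j + 1) * (Lc : ℝ) ^ (3 + 1)) = -(cVH * wVH 3 Lc (j + 1))) :
    (stepScale 3 Lc (j + 1) * (Lc : ℝ) ^ (3 + 1))⁻¹ * (cE * wE 3 Lc (j + 1)) * c3 =
        cE * wE 3 Lc (j + 1) * c3 / (stepScale 3 Lc (j + 1) * (Lc : ℝ) ^ (3 + 1)) ∧
      (stepScale 3 Lc (j + 1) * (Lc : ℝ) ^ (3 + 1))⁻¹ * (cVH * wVH 3 Lc (j + 1)) =
        -(cE * wE 3 Lc (j + 1) * c3 / (stepScale 3 Lc (j + 1) * (Lc : ℝ) ^ (3 + 1)) * (stepScale 3 Lc (j + 1) * (Lc : ℝ) ^ (3 + 1))) := by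
  have hL : (Lc : ℝ) ≠ 0 := by exact_mod_cast (NeZero.ne Lc)
  have hS : stepScale 3 Lc (j + 1) ≠ 0 := by unfold stepScale; exact pow_ne_zero _ (pow_ne_zero _ hL)
  have hP : stepScale 3 Lc (j + 1) * (Lc : ℝ) ^ (3 + 1) ≠ 0 := mul_ne_zero hS (pow_ne_zero _ hL)
  refine ⟨by field_simp, ?_⟩
  have hv : cVH * wVH 3 Lc (j + 1) = -(cE * wE 3 Lc (j + 1) * c3 * (stepScale 3 Lc (j + 1) * (Lc : ℝ) ^ (3 + 1))) := by
    linarith [hlock]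
  rw [hv]; field_simp

end Scalars

/-! ## §3 Level zero assembled: the Wilson Ward divergence law, the scalar lock and the W-side remain -/
section Zero
variable {Lc : ℕ} [NeZero Lc]

/-- **LEVEL ZERO OF hW, ASSEMBLED BY NAME.**  Member `0` of the wall binder hW for the centred native spine follows from:
(i) `hEw` — the WILSON WARD DIVERGENCE LAW of the first-order Wilson cubic stencil against the `d*d`-window border of the rooted bordered Hessian,
with some constant `cE'` (statement-level here; cell item (W-LS0-E); the three-engine toy of an1-g26 finds `cE' = 1/2` at `d = 1, 2, 3`);
(ii) `hlock` — the SCALAR LOCK `cE·cE'·Lc⁴ = −cVH` tying the wall literal's first-order weights to `cE'` (`WardLocusS0N.lock_solvable_iff`; at `cE' = 1/2`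
it is hR's normalisation hyperplane `2·cVH = −cE·Lc⁴` of `S0NReflection.S0NAt_bref_iff` — ONE hyperplane serves both kernel binders);
(iii) the W-side at level `0` — contact / remainder families `X₂`, `Nr` (localised, `X₂` commuting with `axEc`), the pure-gauge law `hWd` of `W 0` against
`𝕄₀ = bhKAt 3 ρ_c Lc` and the DETERMINED generator `X₀ y = diagK ((cE·cE'/Lc⁴) • Σ_{v ∈ box} legInd ρ_c (Lc•y + v))`, and the tadpole-free remainder `hN0`.
Plugged BY NAME: §2 (an2's relative inverse, leaf-07's ℋ-column law), §1 (hX, hEX), leaf-10's `hSd_S0NAt_of_wilsonWard` (hSd), §3⁰ (the lock).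
[folklore] -/
theorem wardTransversal_flipK_TbalOf_JsBalBmNAtOf_ctrC_zero_of_wilsonWard (hLc : Odd Lc) (cE cVH cΛ cE' : ℝ)
    (W : ℕ → Fin 4 → (Fin 4 → ℤ) → Fin 4 → (Fin 4 → ℤ) → MKer 4 (Fib 3)) (Cw δw : ℕ → ℝ) (hδw : ∀ j, 0 < δw j)
    (hW : ∀ j, VertexFamily₂ (W j) Lc (Cw j) (δw j))
    (hWt : ∀ (j : ℕ) (μ : Fin 4) (y : Fin 4 → ℤ) (ν : Fin 4) (y' t : Fin 4 → ℤ),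
      W j μ (y + t) ν (y' + t) = shiftK (-((Lc : ℤ) • t)) (W j μ y ν y'))
    (hEw : ∀ u : Fin 4 → ℤ,
      divV (wilsonA 3) u = cE' • conjV (ffK (bhKAt 3 (toSite (ctrOff 4 Lc)) Lc)) (diagK (legInd (toSite (ctrOff 4 Lc)) u)))
    (hlock : cE * cE' * (Lc : ℝ) ^ (3 + 1) = -cVH)
    (X₂ Nr : (Fin 4 → ℤ) → Fin 4 → (Fin 4 → ℤ) → MKer 4 (Fib 3)) (hX₂ : ∀ y ν y', Loc (X₂ y ν y')) (hNr : ∀ y ν y', Loc (Nr y ν y'))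
    (hEX₂ : ∀ y ν y', comp (axEc (toSite (ctrOff 4 Lc)) Lc) (X₂ y ν y') = comp (X₂ y ν y') (axEc (toSite (ctrOff 4 Lc)) Lc))
    (hWd : ∀ (y : Fin 4 → ℤ) (ν : Fin 4) (y' : Fin 4 → ℤ),
      divW (W 0) y ν y' =
        conjW (bhKAt 3 (toSite (ctrOff 4 Lc)) Lc) 0
          (vertexOfK (coDressKBmAt (toSite (ctrOff 4 Lc)) Lc (KInvStep (d := 3) Lc 0)) Lc (S0NAt 3 Lc (toSite (ctrOff 4 Lc)) cE cVH cΛ) ν y')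
          (diagK ((cE * cE' / (Lc : ℝ) ^ (3 + 1)) • ∑ v ∈ box 4 Lc, legInd (toSite (ctrOff 4 Lc)) ((Lc : ℤ) • y + toSite v))) 0 (X₂ y ν y')
        + Nr y ν y')
    (hN0 : ∀ y ν y', tadpole (coDressKBmAt (toSite (ctrOff 4 Lc)) Lc (KInvStep (d := 3) Lc 0)) (Nr y ν y') = 0) :
    WardTransversal (flipK (TbalOf Lc (JsBalBmNAtOf (d := 3) hLc.pos (ctrOff_mem_box hLc.pos) cE cVH cΛ W Cw δw hδw hW) 0)) := by
  obtain ⟨h₁, h₂⟩ := lock_zero hlock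
  refine wardTransversal_flipK_TbalOf_JsBalBmNAtOf_ctrC_level hLc cE cVH cΛ W Cw δw hδw hW hWt 0
    (fun y => diagK ((cE * cE' / (Lc : ℝ) ^ (3 + 1)) • ∑ v ∈ box 4 Lc, legInd (toSite (ctrOff 4 Lc)) ((Lc : ℤ) • y + toSite v)))
    (fun y => loc_diagK_smul_sum_legInd Lc _ _ y) (fun y => comp_axEc_diagK_comm _ _ _) X₂ Nr hX₂ hNr hEX₂ ?_ ?_ hN0
  · intro y
    rw [JsBal0NAtOf_S_zero, bhKStepAt_zero]
    exact hSd_S0NAt_of_wilsonWard hLc.pos (ctrOff_mem_box hLc.pos) hEw h₁ h₂ y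
  · intro y ν y'
    rw [JsBal0NAtOf_S_zero, bhKStepAt_zero]
    exact hWd y ν y'

end Zero

/-! ## §4 Level `j+1` assembled: the value-function cubic Ward law, the scalar lock and the W-side remain -/
section Succ
variable {Lc : ℕ} [NeZero Lc]

/-- **LEVEL `j+1` OF hW, ASSEMBLED BY NAME.**  Member `j+1` of the wall binder hW follows from:
(i′) `he3` — the WARD DIVERGENCE LAW OF THE VALUE-FUNCTION CUBIC STENCIL `e3NAtOf 3 Lc ρ_c cE cVH cΛ (j+1)` against the `d*d`-window border of
`bhKStepAt 3 ρ_c Lc (j+1)`, with some constant `c3` (statement-level here; `WardLocusCubic.divV_e3NAtOf_eq_conjV` (leaf-10) reduces it to the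
composite block Ward law of the composite chart `KInv (N := Lc^(j+1))`);
(ii′) `hlock` — the SCALAR LOCK `cE·wE(j+1)·c3·(stepScale (j+1)·Lc⁴) = −cVH·wVH(j+1)`;
(iii′) the W-side at level `j+1` against `𝕄_{j+1} = bhKStepAt 3 ρ_c Lc (j+1)` and the DETERMINED generator `X_{j+1} y = diagK (ξ • Σ …)`,
`ξ = cE·wE(j+1)·c3 / (stepScale (j+1)·Lc⁴)`.
Plugged BY NAME: §2, §1, leaf-10's `hSd_SstepNAt_of_e3Ward`, §3⁰.  [folklore] -/
theorem wardTransversal_flipK_TbalOf_JsBalBmNAtOf_ctrC_succ_of_e3Ward (hLc : Odd Lc) (cE cVH cΛ : ℝ) (j : ℕ) (c3 : ℝ)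
    (W : ℕ → Fin 4 → (Fin 4 → ℤ) → Fin 4 → (Fin 4 → ℤ) → MKer 4 (Fib 3)) (Cw δw : ℕ → ℝ) (hδw : ∀ j, 0 < δw j)
    (hW : ∀ j, VertexFamily₂ (W j) Lc (Cw j) (δw j))
    (hWt : ∀ (j : ℕ) (μ : Fin 4) (y : Fin 4 → ℤ) (ν : Fin 4) (y' t : Fin 4 → ℤ),
      W j μ (y + t) ν (y' + t) = shiftK (-((Lc : ℤ) • t)) (W j μ y ν y'))
    (he3 : ∀ u : Fin 4 → ℤ, divV (e3NAtOf 3 Lc (toSite (ctrOff 4 Lc)) cE cVH cΛ (j + 1)) u =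
      c3 • conjV (ffK (bhKStepAt 3 (toSite (ctrOff 4 Lc)) Lc (j + 1))) (diagK (legInd (toSite (ctrOff 4 Lc)) u)))
    (hlock : cE * wE 3 Lc (j + 1) * c3 * (stepScale 3 Lc (j + 1) * (Lc : ℝ) ^ (3 + 1)) = -(cVH * wVH 3 Lc (j + 1)))
    (X₂ Nr : (Fin 4 → ℤ) → Fin 4 → (Fin 4 → ℤ) → MKer 4 (Fib 3)) (hX₂ : ∀ y ν y', Loc (X₂ y ν y')) (hNr : ∀ y ν y', Loc (Nr y ν y'))
    (hEX₂ : ∀ y ν y', comp (axEc (toSite (ctrOff 4 Lc)) Lc) (X₂ y ν y') = comp (X₂ y ν y') (axEc (toSite (ctrOff 4 Lc)) Lc))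
    (hWd : ∀ (y : Fin 4 → ℤ) (ν : Fin 4) (y' : Fin 4 → ℤ),
      divW (W (j + 1)) y ν y' =
        conjW (bhKStepAt 3 (toSite (ctrOff 4 Lc)) Lc (j + 1)) 0
          (vertexOfK (coDressKBmAt (toSite (ctrOff 4 Lc)) Lc (KInvStep (d := 3) Lc (j + 1))) Lc
            (SstepNAt 3 Lc (toSite (ctrOff 4 Lc)) cE cVH cΛ (j + 1)) ν y')
          (diagK ((cE * wE 3 Lc (j + 1) * c3 / (stepScale 3 Lc (j + 1) * (Lc : ℝ) ^ (3 + 1))) •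
            ∑ v ∈ box 4 Lc, legInd (toSite (ctrOff 4 Lc)) ((Lc : ℤ) • y + toSite v))) 0 (X₂ y ν y')
        + Nr y ν y')
    (hN0 : ∀ y ν y', tadpole (coDressKBmAt (toSite (ctrOff 4 Lc)) Lc (KInvStep (d := 3) Lc (j + 1))) (Nr y ν y') = 0) :
    WardTransversal (flipK (TbalOf Lc (JsBalBmNAtOf (d := 3) hLc.pos (ctrOff_mem_box hLc.pos) cE cVH cΛ W Cw δw hδw hW) (j + 1))) := by
  obtain ⟨h₁, h₂⟩ := lock_succ hlock
  refine wardTransversal_flipK_TbalOf_JsBalBmNAtOf_ctrC_level hLc cE cVH cΛ W Cw δw hδw hW hWt (j + 1)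
    (fun y => diagK ((cE * wE 3 Lc (j + 1) * c3 / (stepScale 3 Lc (j + 1) * (Lc : ℝ) ^ (3 + 1))) •
      ∑ v ∈ box 4 Lc, legInd (toSite (ctrOff 4 Lc)) ((Lc : ℤ) • y + toSite v)))
    (fun y => loc_diagK_smul_sum_legInd Lc _ _ y) (fun y => comp_axEc_diagK_comm _ _ _) X₂ Nr hX₂ hNr hEX₂ ?_ ?_ hN0
  · intro y
    rw [JsBal0NAtOf_S_succ]
    exact hSd_SstepNAt_of_e3Ward hLc.pos (ctrOff_mem_box hLc.pos) he3 h₁ h₂ y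
  · intro y ν y'
    rw [JsBal0NAtOf_S_succ]
    exact hWd y ν y'

end Succ

/-! ## §5 Every level: the wall binder hW from the two first-order Ward laws, the scalar locks and the W-side -/
section All
variable {Lc : ℕ} [NeZero Lc]

/-- **hW FROM THE WARD LAWS — THE ROOT ASSEMBLED BY NAME AT EVERY LEVEL.**  CONCLUSION: LITERALLY the binder
`hW : ∀ j, WardTransversal (flipK (TbalOf Lc (JsBalBmNAtOf (d := 3) hLc.pos (ctrOff_mem_box hLc.pos) cE cVH cΛ W Cw δw hδw hW) j))` of
`OneStepKernelFamily.d1Drift_of_D1Tel_D1Rep` for the wall family.  HYPOTHESES, exactly: the block covariance of the supplied second-order tables `hWt`;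
(i) the WILSON WARD DIVERGENCE LAW `hEw` (constant `cE'`; item (W-LS0-E), statement-level); (i′) the VALUE-FUNCTION CUBIC WARD LAWS `he3` at every
level `j+1` (constants `c3 (j+1)`; statement-level — `WardLocusCubic` reduces each to the composite block Ward law); (ii) the LOCKS `hlock₀`, `hlock`
(scalar identities between the wall literal's weights `cE, cVH, wE, wVH, stepScale, Lc⁴` and the Ward constants); (iii) the W-SIDE (L4): contact /
remainder families `X₂ j`, `Nr j` (localised, `X₂` commuting with `axEc ρ_c Lc`), the pure-gauge second-order law `hWd` of `W j` against
`𝕄 j = bhKStepAt 3 ρ_c Lc j` and the determined generator `diagK (xiAt Lc cE cE' c3 j • Σ_{v ∈ box} legInd ρ_c (Lc•y + v))`, the tadpole-free remainder `hN0`.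
DISCHARGED INSIDE, BY NAME: (W-L1) an2's relative inverse at every step, (W-LH) leaf-07's ℋ-column Ward law at every step, hX/hEX (§1), hSd at every
level (leaf-10's `hSd_S0NAt_of_wilsonWard` / `hSd_SstepNAt_of_e3Ward` + §3⁰).  Nothing of the wall is instantiated: (i), (i′), (ii), (iii) are
hypotheses.  [folklore] -/
theorem wardTransversal_flipK_TbalOf_JsBalBmNAtOf_ctrC_of_wardLaws (hLc : Odd Lc) (cE cVH cΛ cE' : ℝ) (c3 : ℕ → ℝ)
    (W : ℕ → Fin 4 → (Fin 4 → ℤ) → Fin 4 → (Fin 4 → ℤ) → MKer 4 (Fib 3)) (Cw δw : ℕ → ℝ) (hδw : ∀ j, 0 < δw j)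
    (hW : ∀ j, VertexFamily₂ (W j) Lc (Cw j) (δw j))
    (hWt : ∀ (j : ℕ) (μ : Fin 4) (y : Fin 4 → ℤ) (ν : Fin 4) (y' t : Fin 4 → ℤ),
      W j μ (y + t) ν (y' + t) = shiftK (-((Lc : ℤ) • t)) (W j μ y ν y'))
    (hEw : ∀ u : Fin 4 → ℤ,
      divV (wilsonA 3) u = cE' • conjV (ffK (bhKAt 3 (toSite (ctrOff 4 Lc)) Lc)) (diagK (legInd (toSite (ctrOff 4 Lc)) u)))
    (he3 : ∀ (j : ℕ) (u : Fin 4 → ℤ), divV (e3NAtOf 3 Lc (toSite (ctrOff 4 Lc)) cE cVH cΛ (j + 1)) u =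
      c3 (j + 1) • conjV (ffK (bhKStepAt 3 (toSite (ctrOff 4 Lc)) Lc (j + 1))) (diagK (legInd (toSite (ctrOff 4 Lc)) u)))
    (hlock₀ : cE * cE' * (Lc : ℝ) ^ (3 + 1) = -cVH)
    (hlock : ∀ j : ℕ, cE * wE 3 Lc (j + 1) * c3 (j + 1) * (stepScale 3 Lc (j + 1) * (Lc : ℝ) ^ (3 + 1)) = -(cVH * wVH 3 Lc (j + 1)))
    (X₂ Nr : ℕ → (Fin 4 → ℤ) → Fin 4 → (Fin 4 → ℤ) → MKer 4 (Fib 3)) (hX₂ : ∀ j y ν y', Loc (X₂ j y ν y'))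
    (hNr : ∀ j y ν y', Loc (Nr j y ν y'))
    (hEX₂ : ∀ j y ν y', comp (axEc (toSite (ctrOff 4 Lc)) Lc) (X₂ j y ν y') = comp (X₂ j y ν y') (axEc (toSite (ctrOff 4 Lc)) Lc))
    (hWd : ∀ (j : ℕ) (y : Fin 4 → ℤ) (ν : Fin 4) (y' : Fin 4 → ℤ),
      divW (W j) y ν y' =
        conjW (bhKStepAt 3 (toSite (ctrOff 4 Lc)) Lc j) 0
          (vertexOfK (coDressKBmAt (toSite (ctrOff 4 Lc)) Lc (KInvStep (d := 3) Lc j)) Lc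
            (JsBal0NAtOf (d := 3) hLc.pos (ctrOff_mem_box hLc.pos) cE cVH cΛ W Cw δw hδw hW j).S ν y')
          (diagK (xiAt Lc cE cE' c3 j • ∑ v ∈ box 4 Lc, legInd (toSite (ctrOff 4 Lc)) ((Lc : ℤ) • y + toSite v))) 0 (X₂ j y ν y')
        + Nr j y ν y')
    (hN0 : ∀ j y ν y', tadpole (coDressKBmAt (toSite (ctrOff 4 Lc)) Lc (KInvStep (d := 3) Lc j)) (Nr j y ν y') = 0) :
    ∀ j : ℕ, WardTransversal
      (flipK (TbalOf Lc (JsBalBmNAtOf (d := 3) hLc.pos (ctrOff_mem_box hLc.pos) cE cVH cΛ W Cw δw hδw hW) j)) := by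
  intro j
  refine wardTransversal_flipK_TbalOf_JsBalBmNAtOf_ctrC_level hLc cE cVH cΛ W Cw δw hδw hW hWt j
    (fun y => diagK (xiAt Lc cE cE' c3 j • ∑ v ∈ box 4 Lc, legInd (toSite (ctrOff 4 Lc)) ((Lc : ℤ) • y + toSite v)))
    (fun y => loc_diagK_smul_sum_legInd Lc _ _ y) (fun y => comp_axEc_diagK_comm _ _ _) (X₂ j) (Nr j) (hX₂ j) (hNr j) (hEX₂ j) ?_
    (hWd j) (hN0 j)
  intro y
  cases j with
  | zero =>
    obtain ⟨h₁, h₂⟩ := lock_zero hlock₀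
    rw [JsBal0NAtOf_S_zero, bhKStepAt_zero, xiAt_zero]
    exact hSd_S0NAt_of_wilsonWard hLc.pos (ctrOff_mem_box hLc.pos) hEw h₁ h₂ y
  | succ j =>
    obtain ⟨h₁, h₂⟩ := lock_succ (hlock j)
    rw [JsBal0NAtOf_S_succ, xiAt_succ]
    exact hSd_SstepNAt_of_e3Ward hLc.pos (ctrOff_mem_box hLc.pos) (he3 j) h₁ h₂ y

end All

end Summit.QuantumFields.BalabanUV.Beta.KernelWardLevels

end
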